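import Summits.Ventures.QEC.CircuitDistance.PortK2DataBB144Z
import Summits.Ventures.QEC.CircuitDistance.K2Chunks
import HarnessLib

/-!
# K2(`[[144,12,12]]`) chunk module — COMPUTATIONAL (native_decide; `Lean.ofReduceBool`)

Cell `qec`, CDX, R146/R152 STEP 1 («computational» header; `ofReduceBool` confined to these chunk modules). Checker of record
`K2.K2Data` (qec-cdx-type-1, PortK2Check); data module of record `PortK2DataBB144X/Z` (p669158/9, crit-1 data audit PASS
2026-08-28T21:20Z); chunk glue `K2Chunks` (idea-1 g2). Cube 0, child 3: leaf group 8 of 12.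
Leaf theorems: the K2 DFS accepts below one descendant state of pivot cube 0 (sector Z); sizes are exact DFS visit counts
(eng-1 g2 `k2count.c`), capped so that the gate's native-axiom audit re-verifies every leaf in place. Assemblies re-derive the
child lists in the kernel (`decide`) and end in the literal cube fact `d144Z.cube (Ts144Z.getD 0 []) (0) (lives144Z.getD 0 0) = true`
(the `hcubes` hypothesis of `K2Inst.k2_complete`). Emitted by qec-cdx-eng-1 g2 (`gen2.py`, idea-1's `gen_k2chunks_from_lean.py` lineage).
-/

namespace Summit.Ventures.QEC.CircuitDistance.K2

set_option maxRecDepth 100000 in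
set_option maxHeartbeats 0 in
set_option exponentiation.threshold 1024 in
/-- K2(144) chunk fact `cube144Z0_ch3_10` (707139 DFS visits; see the module docstring). -/
theorem cube144Z0_ch3_10 : app5 (d144Z.dfs (Ts144Z.getD 0 []) 6) (1180609635117130860672, 3528, 766247770432944429179173513579990295087828077790625793, 3, 2348542582773833227889480596789337027375682548908319869929047009761040569831544576306356171076358828344737756) = true := by native_decide

set_option maxRecDepth 100000 in
set_option maxHeartbeats 0 in
set_option exponentiation.threshold 1024 in
/-- K2(144) chunk fact `cube144Z0_ch3_11` (770786 DFS visits; see the module docstring). -/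
theorem cube144Z0_ch3_11 : app5 (d144Z.dfs (Ts144Z.getD 0 []) 6) (1330491717698996666496, 832, 842498333348457493583344221469363458551165598907671348551186644993, 3, 2348542582773833227889480596789337027375681706409986521471553426416819100468086025145592966683468793856917468) = true := by native_decide

set_option maxRecDepth 100000 in
set_option maxHeartbeats 0 in
set_option exponentiation.threshold 1024 in
/-- K2(144) chunk fact `cube144Z0_ch3_12` (665848 DFS visits; see the module docstring). -/
theorem cube144Z0_ch3_12 : app5 (d144Z.dfs (Ts144Z.getD 0 []) 6) (3541829468297715778176, 424, 13479973333575319897333507543509815336818577046973564699068503949313, 3, 2348542582773833227889480596789337027375668226436652946151656092909275590652749206573381696397228242051792860) = true := by native_decide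
end Summit.Ventures.QEC.CircuitDistance.K2
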